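import Summits.CriticalPhenomena.PercolationContinuityZ3.Theorems.PercNearOneGluingNoHeavyQuantPolylogOneArm
import Summits.CriticalPhenomena.PercolationContinuityZ3.Theorems.PercNearOneGluingNoHeavyQuantThetaModulusR4
import HarnessLib

/-!
# Polynomial-aspect crossing defect at `p_c` ⇒ an explicit `1/log` modulus of continuity for `θ` at `p_c⁺`
# (quant lane: rung R3″ of `prim-quant-p3` composed with rung R4 of `prim-quant-p4`)

builds on p205010 (kernel theorem, internal audit signed; external expert review pending).
Status sentence for p205010: "θ(p_c) = 0 on ℤ^d, all d ≥ 2 — kernel-verified (Lean 4/Mathlib, standard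
axioms); internal adversarial audit SIGNED 2026-08-20 04:29Z; external expert review pending."

Seat `prim-quant-p4`, `--supports stmt-CriticalPhenomena-4575`; pure proofs (composition + bookkeeping).

Input 1 (R3″, `Quant.oneArmProb_le_const_mul_log_rpow_neg`, seat p3): if for some `α ≥ 1`, `n₀ ≥ 2`, `δ ∈ (0,1)` the
box crossings `Λ(n) ↔ ∂Λ(n^α)` at parameter `p` have a UNIFORM defect, `P_p(boxCrossing d n (n^α)) ≤ 1 − δ` for all
`n ≥ n₀`, then `π_p(N) ≤ A (log N)^{−c}` for `N ≥ n₀`, `c = −log(1−δ)/log(2α)`, `A = (1−δ)^{−1}(2 log n₀)^c`.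
Input 2 (R4, `ThetaModulus.theta_le_logModulus_of_oneArmLogDecay`): a log one-arm rate at `p_c` gives
`θ(p) ≤ 2A d^c (log(1/(p − p_c)))^{−c} + (2d·5^d/(p_c(1−p_c)))(p − p_c)`.

* `theta_le_logModulus_of_polyAspectDefect` — the composition at `p = p_c`, `d ≥ 2`, `p_c < p ≤ (1+p_c)/2`
  (the range `2 ≤ N < n₀` is covered because `A (log N)^{−c} ≥ (1−δ)^{−1} 2^c ≥ 1`);
* `thetaModulusNearCritical_of_polyAspectDefect` — the same packaged as `Quant.ThetaModulusNearCritical d ω_log`,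
  `ω_log(t) = 2A d^c (log(1/t))^{−c} + (2d·5^d/(p_c(1−p_c))) t` on `t ≤ (1−p_c)/2` (`1` beyond), `ω_log(0⁺) = 0`.

Honest scope: the polynomial-aspect crossing defect AT `p_c` is an OPEN RSW-type statement in `d = 3` (a scale-invariant
finite-size criterion; QUANT.md §5 Q-AG3, LADDER R3); this file is the reduction "leaf ⇒ (T2) with `ω = C₁/log(1/t)^c + C₂t`".
-/

noncomputable section

namespace Summit.CriticalPhenomena.PercolationContinuityZ3.Theorems

namespace ThetaModulus

open MeasureTheory Set Filter Topology Literature.Probability.Percolation Literature.Probability.LatticeModels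
open scoped Classical

variable {d : ℕ}

/-- **Polynomial-aspect crossing defect at `p_c` ⇒ `1/log` modulus.**  For `d ≥ 2`, `α ≥ 1`, `n₀ ≥ 2`, `0 < δ < 1`:
if `P_{p_c}(Λ(n) ↔ ∂Λ(n^α)) ≤ 1 − δ` for all `n ≥ n₀`, then for `p_c < p ≤ (1 + p_c)/2`, with
`c = −log(1−δ)/log(2α)` and `A = (1−δ)^{−1}(2 log n₀)^c`,
`θ(p) ≤ 2A·d^c·(log(1/(p − p_c)))^{−c} + (2d·5^d/(p_c(1−p_c)))·(p − p_c)`.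
Composition of `Quant.oneArmProb_le_const_mul_log_rpow_neg` (p3, R3″) with `theta_le_logModulus_of_oneArmLogDecay` (R4).
Conditional on the open crossing-defect leaf; the reduction is new. -/
theorem theta_le_logModulus_of_polyAspectDefect (hd : 2 ≤ d) {α n₀ : ℕ} (hα : 1 ≤ α) (hn₀ : 2 ≤ n₀)
    {δ : ℝ} (hδ0 : 0 < δ) (hδ1 : δ < 1)
    (hdef : ∀ n, n₀ ≤ n →
      (bondPercolation (zdGraph d) (criticalProbI d)).real (SurfaceTension.boxCrossing d n (n ^ α)) ≤ 1 - δ)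
    (p : unitInterval) (hpc : (criticalProbI d : ℝ) < p) (hp : (p : ℝ) ≤ (1 + criticalProbI d) / 2) :
    theta (zdGraph d) 0 p ≤
      2 * ((1 - δ)⁻¹ * (2 * Real.log n₀) ^ (-Real.log (1 - δ) / Real.log (2 * α))) *
          (d : ℝ) ^ (-Real.log (1 - δ) / Real.log (2 * α)) *
          (Real.log (1 / ((p : ℝ) - criticalProbI d))) ^ (-(-Real.log (1 - δ) / Real.log (2 * α))) +
        2 * d * 5 ^ d / ((criticalProbI d : ℝ) * (1 - criticalProbI d)) * ((p : ℝ) - criticalProbI d) := by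
  set c : ℝ := -Real.log (1 - δ) / Real.log (2 * α) with hc
  set A : ℝ := (1 - δ)⁻¹ * (2 * Real.log n₀) ^ c with hA
  have hρ0 : 0 < 1 - δ := by linarith
  have hρ1 : 1 - δ < 1 := by linarith
  have hlogρ : Real.log (1 - δ) < 0 := Real.log_neg hρ0 hρ1
  have h2α : (1 : ℝ) < 2 * α := by
    have : (1 : ℝ) ≤ α := by exact_mod_cast hα
    linarith
  have hlog2α : 0 < Real.log (2 * α) := Real.log_pos h2α
  have hc0 : 0 < c := by rw [hc]; exact div_pos (by linarith) hlog2α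
  have hn₀r : (1 : ℝ) < n₀ := by exact_mod_cast (show 1 < n₀ by omega)
  have hlogn₀ : 0 < Real.log n₀ := Real.log_pos hn₀r
  have hA0 : 0 ≤ A := by rw [hA]; positivity
  -- the log one-arm rate for all `n ≥ 2`
  have hdecay : ∀ n : ℕ, 2 ≤ n → oneArmProb d (criticalProbI d) n ≤ A * (Real.log n) ^ (-c) := by
    intro n hn
    by_cases hnn₀ : n₀ ≤ n
    · have h := Quant.oneArmProb_le_const_mul_log_rpow_neg (d := d) (criticalProbI d) hα hn₀ hδ0 hδ1 hdef hnn₀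
      rw [← hc] at h
      exact h
    · -- `2 ≤ n < n₀`: `π ≤ 1 ≤ (1-δ)⁻¹ 2^c ≤ A (log n)^{-c}`
      push Not at hnn₀
      have hnr : (1 : ℝ) < n := by exact_mod_cast (show 1 < n by omega)
      have hlogn : 0 < Real.log n := Real.log_pos hnr
      have hlogle : Real.log n ≤ Real.log n₀ :=
        Real.log_le_log (by positivity) (by exact_mod_cast hnn₀.le)
      have hπ1 : oneArmProb d (criticalProbI d) n ≤ 1 := by unfold oneArmProb; exact measureReal_le_one
      refine hπ1.trans ?_
      have h1 : (Real.log n₀) ^ (-c) ≤ (Real.log n) ^ (-c) :=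
        Real.rpow_le_rpow_of_nonpos hlogn hlogle (by linarith)
      have h2 : A * (Real.log n₀) ^ (-c) = (1 - δ)⁻¹ * 2 ^ c := by
        rw [hA, Real.mul_rpow (by norm_num) hlogn₀.le, Real.rpow_neg hlogn₀.le]
        field_simp
      have h3 : (1 : ℝ) ≤ (1 - δ)⁻¹ * 2 ^ c := by
        have h31 : (1 : ℝ) ≤ (1 - δ)⁻¹ := (one_le_inv₀ hρ0).2 hρ1.le
        have h32 : (1 : ℝ) ≤ (2 : ℝ) ^ c := Real.one_le_rpow (by norm_num) hc0.le
        nlinarith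
      calc (1 : ℝ) ≤ (1 - δ)⁻¹ * 2 ^ c := h3
        _ = A * (Real.log n₀) ^ (-c) := h2.symm
        _ ≤ A * (Real.log n) ^ (-c) := mul_le_mul_of_nonneg_left h1 hA0
  exact theta_le_logModulus_of_oneArmLogDecay hd hc0 hA0 hdecay p hpc hp

/-- **The same in the lane's vocabulary: `Quant.ThetaModulusNearCritical d ω_log`** with the explicit
`ω_log(t) = 2A·d^c·(log(1/t))^{−c} + (2d·5^d/(p_c(1−p_c)))·t` for `t ≤ (1−p_c)/2` and `ω_log(t) = 1` beyond
(`A = (1−δ)^{−1}(2 log n₀)^c`, `c = −log(1−δ)/log(2α)`; in Lean `ω_log(0) = 0` since `log(1/0) = 0`, `0^{−c} = 0`, and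
`θ(p_c) = 0` is p205010).  Conditional on the open polynomial-aspect crossing-defect leaf at `p_c`.
builds on p205010 (kernel theorem, internal audit signed; external expert review pending). -/
theorem thetaModulusNearCritical_of_polyAspectDefect (hd : 2 ≤ d) {α n₀ : ℕ} (hα : 1 ≤ α) (hn₀ : 2 ≤ n₀)
    {δ : ℝ} (hδ0 : 0 < δ) (hδ1 : δ < 1)
    (hdef : ∀ n, n₀ ≤ n →
      (bondPercolation (zdGraph d) (criticalProbI d)).real (SurfaceTension.boxCrossing d n (n ^ α)) ≤ 1 - δ) :
    Quant.ThetaModulusNearCritical d (fun t =>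
      if t ≤ (1 - (criticalProbI d : ℝ)) / 2 then
        2 * ((1 - δ)⁻¹ * (2 * Real.log n₀) ^ (-Real.log (1 - δ) / Real.log (2 * α))) *
            (d : ℝ) ^ (-Real.log (1 - δ) / Real.log (2 * α)) *
            (Real.log (1 / t)) ^ (-(-Real.log (1 - δ) / Real.log (2 * α))) +
          2 * d * 5 ^ d / ((criticalProbI d : ℝ) * (1 - criticalProbI d)) * t
      else 1) := by
  set c : ℝ := -Real.log (1 - δ) / Real.log (2 * α) with hc
  set K : ℝ := 2 * ((1 - δ)⁻¹ * (2 * Real.log n₀) ^ c) * (d : ℝ) ^ c with hK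
  set C₂ : ℝ := 2 * d * 5 ^ d / ((criticalProbI d : ℝ) * (1 - criticalProbI d)) with hC₂
  have hρ0 : 0 < 1 - δ := by linarith
  have hρ1 : 1 - δ < 1 := by linarith
  have h2α : (1 : ℝ) < 2 * α := by
    have : (1 : ℝ) ≤ α := by exact_mod_cast hα
    linarith
  have hc0 : 0 < c := by rw [hc]; exact div_pos (by linarith [Real.log_neg hρ0 hρ1]) (Real.log_pos h2α)
  have hpc1 : (criticalProbI d : ℝ) < 1 := by
    rw [coe_criticalProbI]; exact criticalProb_zd_lt_one hd
  -- the formula near `0`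
  set G : ℝ → ℝ := fun t => K * (Real.log (1 / t)) ^ (-c) + C₂ * t with hG
  have hG0 : G 0 = 0 := by
    simp only [hG, div_zero, Real.log_zero, Real.zero_rpow (neg_ne_zero.2 hc0.ne'), mul_zero, add_zero]
  have hGpos : Tendsto G (𝓝[>] 0) (𝓝 0) := by
    have h1 : Tendsto (fun t : ℝ => Real.log (1 / t)) (𝓝[>] 0) atTop := by
      have h := tendsto_neg_atBot_atTop.comp Real.tendsto_log_nhdsGT_zero
      refine h.congr' (Eventually.of_forall fun t => ?_)
      simp only [Function.comp, one_div, Real.log_inv]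
    have h2 : Tendsto (fun t : ℝ => (Real.log (1 / t)) ^ (-c)) (𝓝[>] 0) (𝓝 0) :=
      (tendsto_rpow_neg_atTop hc0).comp h1
    have h3 : Tendsto (fun t : ℝ => K * (Real.log (1 / t)) ^ (-c)) (𝓝[>] 0) (𝓝 0) := by
      simpa using h2.const_mul K
    have h4 : Tendsto (fun t : ℝ => C₂ * t) (𝓝[>] 0) (𝓝 0) := by
      have : Tendsto (fun t : ℝ => C₂ * t) (𝓝 0) (𝓝 (C₂ * 0)) :=
        (continuous_const.mul continuous_id).tendsto 0
      rw [mul_zero] at this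
      exact this.mono_left nhdsWithin_le_nhds
    have h5 := h3.add h4
    rw [add_zero] at h5
    exact h5
  have hGge : Tendsto G (𝓝[≥] 0) (𝓝 0) := by
    have h : ContinuousWithinAt G (Ioi 0) 0 := by
      rw [ContinuousWithinAt, hG0]; exact hGpos
    have h' := continuousWithinAt_Ioi_iff_Ici.1 h
    rw [ContinuousWithinAt, hG0] at h'
    exact h'
  refine ⟨?_, fun p hp => ?_⟩
  · have hev : ∀ᶠ t in 𝓝[≥] (0 : ℝ), t ≤ (1 - (criticalProbI d : ℝ)) / 2 :=
      eventually_nhdsWithin_of_eventually_nhds (eventually_le_nhds (by linarith))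
    refine hGge.congr' ?_
    filter_upwards [hev] with t ht
    rw [if_pos ht]
  · dsimp only
    by_cases ht : (p : ℝ) - criticalProbI d ≤ (1 - (criticalProbI d : ℝ)) / 2
    · rw [if_pos ht]
      rcases hp.eq_or_lt with heq | hlt
      · -- `p = p_c`: both sides vanish (θ(p_c) = 0 is p205010)
        have hp' : p = criticalProbI d := Subtype.ext heq.symm
        have h0 : theta (zdGraph d) 0 p = 0 := by
          rw [hp']; exact CSH.percolationContinuity_allDimensions d hd
        have hs0 : (p : ℝ) - criticalProbI d = 0 := by rw [← heq, sub_self]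
        rw [h0, hs0]
        simp only [div_zero, Real.log_zero, Real.zero_rpow (neg_ne_zero.2 hc0.ne'), mul_zero, add_zero]
        exact le_rfl
      · exact theta_le_logModulus_of_polyAspectDefect hd hα hn₀ hδ0 hδ1 hdef p hlt (by linarith)
    · rw [if_neg ht]
      exact theta_le_one _ _ _

end ThetaModulus

end Summit.CriticalPhenomena.PercolationContinuityZ3.Theorems
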